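import Mathlib
import Summits.NavierStokesRegularity.NavierStokesRegularity.Theorems.EulerZoomLiouvillePowerGaugeEulerLiouvilleDSSSimilarityDepletionMember
import Summits.NavierStokesRegularity.NavierStokesRegularity.Theorems.EulerZoomLiouvillePowerGaugeEulerLiouvilleDSSNodeConvergence
import Summits.NavierStokesRegularity.NavierStokesRegularity.Theorems.EulerZoomLiouvillePowerGaugeEulerLiouvilleDSSVorticalNodeThin
import HarnessLib.Audit

/-!
# Crux E `PowerGaugeEulerLiouville` (stmt-NavierStokesRegularity-19832): THE DSS BERNOULLI-CLOCKED STRATUM WITH FINITELY MANY PERMANENT NODES —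
# the node clause is needed at NON-VORTICAL nodes only; vortical nodes are thin
# (width seat ns-cas-k2 g3, lane «DSS thin vortical nodes», tool C part 2 = the member theorem)

Route `EulerZoomLiouville` (NavierStokesRegularity), crux E.  Sequel to g2's `…DSSSimilarityDepletionMember` (`ae_eq_zero_of_gauge_of_dss_of_clock_depletion`:
tame `l`-DSS member + sub-Bernoulli pressure clock + DEPLETED permanent nodes — Chae's rate `≤ κ < 1` along the vorticity at VORTICAL permanent nodes and the
full stretching form `≤ κ` at NON-vortical ones ⇒ trivial).  With the node theorem of this lane (`DSSNodes.volume_setOf_tendsto_vorticalNode_eq_zero`: in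
the window `ρ > 0` the backward basin of a VORTICAL permanent node along the phase lattice is Lebesgue-null) the clause at vortical nodes can be DROPPED as soon
as the resting confined trajectories converge to single nodes, which holds when every ball carries FINITELY MANY permanent nodes
(`DSSNodes.exists_tendsto_lattice_of_finite_nodes`):
* `eventually_subcritical_of_tendsto_node` — a resting trajectory converging (phase lattice) to a permanent node that is subcritical in the full form at every
  phase is eventually subcritical (g2's compactness argument with the limit node prescribed);
* `curl_node_eq_zero_of_phase` — a permanent node non-vortical at one phase is non-vortical at every phase (Cauchy's formula along the node);
* `dss_curl_eq_zero_or_tendsto_vorticalNode` — trajectory-level DICHOTOMY: a confined backward trajectory of a clocked tame DSS member either carries no vorticity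
  or converges along the phase lattice to a VORTICAL permanent node of the ball;
* **`ae_eq_zero_of_gauge_of_dss_of_clock_finiteNodes`** — MEMBER THEOREM (every `ρ > 0`): crux hypotheses + classical + `l`-DSS (`u`- and `p`-laws) + tame + pressure
  clock `θ < 1` + for every ball: FINITELY MANY permanent nodes and a constant `κ < 1` bounding the full stretching form `(−t)⟪∇u v,v⟫ ≤ κ‖v‖²` at its
  NON-VORTICAL permanent nodes (nothing at vortical ones) ⇒ `u = 0` a.e.  (The confined vortical set at each `τ₀` lies in the finite union of the null basins.)

WHAT THIS IS NOT: not NS regularity, not the crux E — a stratum of hypothetical DSS blow-up members; 19832 is OPEN. [folklore; Chae2010 (rate α); Robinson1999 Ch. V §5.10.1]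
-/

noncomputable section

set_option linter.dupNamespace false

open MeasureTheory Set Filter Topology Metric Function
open scoped NNReal ENNReal ContDiff InnerProductSpace RealInnerProductSpace

namespace Summit.NavierStokesRegularity.NavierStokesRegularity.Theorems.PowerGaugeEulerLiouville.DSSNodes

open Literature.Analysis Literature.Analysis.FluidPDE Literature.Analysis.FunctionSpaces
open Summit.NavierStokesRegularity.NavierStokesRegularity.Theorems.PowerGaugeEulerLiouville.SimilarityBernoulli
open Summit.NavierStokesRegularity.NavierStokesRegularity.Theorems.PowerGaugeEulerLiouville.VorticityBirth
open Summit.NavierStokesRegularity.NavierStokesRegularity.Theorems.PowerGaugeEulerLiouville.MovingSpherePiercing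

variable {u : ℝ → EuclideanSpace ℝ (Fin 3) → EuclideanSpace ℝ (Fin 3)} {p : ℝ → EuclideanSpace ℝ (Fin 3) → ℝ} {θ ρ l : ℝ}

/-! ### Eventual subcriticality at a prescribed limit node -/

/-- **A RESTING TRAJECTORY CONVERGING TO A SUBCRITICAL NODE IS EVENTUALLY SUBCRITICAL.**  `(u,p)` classical on `(−∞,0)`, `l`-DSS; `X` a particle path at rest
whose phase-lattice similarity positions converge to `y*`; `(−t)⟪∇u(t,(−t)ⁿy*)v,v⟫ ≤ κ‖v‖²` for all `t < 0`, `v`.  Then for `κ' > κ` there is `σ₁ ≤ τ₀` with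
`⟪∇u(s,X(s))v,v⟫ ≤ κ'‖v‖²/(−s)` for `s ≤ σ₁`. [folklore] -/
theorem eventually_subcritical_of_tendsto_node (hcl : IsClassicalEulerSolutionOn (Iio 0) 0 u p) (hl : 1 < l) (hρ : 0 < 2 + ρ)
    (hdss : ∀ τ : ℝ, τ < 0 → ∀ y, u τ y = (l ^ (1 + ρ)) • u ((l ^ (2 + ρ)) * τ) (l • y))
    {X : ℝ → EuclideanSpace ℝ (Fin 3)} {τ₀ κ κ' : ℝ} (hκ : κ < κ') (hτ₀ : τ₀ < 0)
    (hX : ∀ s : ℝ, s < 0 → HasDerivAt X (u s (X s)) s)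
    (hrest : Tendsto (fun s => (-s) ^ (1 - (2 + ρ)⁻¹) * ‖u s (X s) + ((2 + ρ)⁻¹ / (-s)) • X s‖) atBot (𝓝 0))
    {ys : EuclideanSpace ℝ (Fin 3)}
    (hlat : Tendsto (fun j : ℕ => ((-((l ^ (2 + ρ)) ^ j * τ₀)) ^ (-(2 + ρ)⁻¹)) • X ((l ^ (2 + ρ)) ^ j * τ₀)) atTop (𝓝 ys))
    (hnode : ∀ t : ℝ, t < 0 → ∀ v : EuclideanSpace ℝ (Fin 3), (-t) * ⟪fderiv ℝ (u t) ((-t) ^ (2 + ρ)⁻¹ • ys) v, v⟫ ≤ κ * ‖v‖ ^ 2) :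
    ∃ σ₁ : ℝ, σ₁ ≤ τ₀ ∧ ∀ s : ℝ, s ≤ σ₁ → ∀ v : EuclideanSpace ℝ (Fin 3),
      ⟪fderiv ℝ (u s) (X s) v, v⟫ ≤ κ' / (-s) * ‖v‖ ^ 2 := by
  -- adapted from `SimilarityBernoulli.eventually_subcritical_of_permanentNodes`, with the limit node prescribed by `hlat`
  have hl0 : 0 < l := zero_lt_one.trans hl
  set n : ℝ := (2 + ρ)⁻¹ with hn
  set T : ℝ := l ^ (2 + ρ) with hT
  have hT1 : 1 < T := Real.one_lt_rpow hl hρ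
  have hT0 : 0 < T := zero_lt_one.trans hT1
  by_contra H
  push Not at H
  choose sq hsq vq hvq using fun j : ℕ => H (min τ₀ (-(j : ℝ) - 1)) (min_le_left _ _)
  have hsqτ : ∀ j, sq j ≤ τ₀ := fun j => (hsq j).trans (min_le_left _ _)
  have hsqj : ∀ j, sq j ≤ -(j : ℝ) - 1 := fun j => (hsq j).trans (min_le_right _ _)
  have hsq1 : ∀ j, sq j ≤ -1 := fun j => (hsqj j).trans (by have := (Nat.cast_nonneg j : (0:ℝ) ≤ j); linarith)
  have hsq0 : ∀ j, sq j < 0 := fun j => by linarith [hsq1 j]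
  have hsq_bot : Tendsto sq atTop atBot := by
    have h1 : Tendsto (fun j : ℕ => -(j : ℝ) - 1) atTop atBot :=
      tendsto_atBot_add_const_right _ (-1) (tendsto_neg_atTop_atBot.comp tendsto_natCast_atTop_atTop)
    exact tendsto_atBot_mono hsqj h1
  have hvne : ∀ j, vq j ≠ 0 := by
    intro j h
    have := hvq j
    rw [h] at this
    simp at this
  set wq : ℕ → EuclideanSpace ℝ (Fin 3) := fun j => (‖vq j‖⁻¹) • vq j with hwq
  have hwq1 : ∀ j, ‖wq j‖ = 1 := fun j => by
    simp only [hwq]; rw [norm_smul, Real.norm_eq_abs, abs_of_pos (inv_pos.2 (norm_pos_iff.2 (hvne j))),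
      inv_mul_cancel₀ (norm_ne_zero_iff.2 (hvne j))]
  have hbad : ∀ j, κ' < (-sq j) * ⟪fderiv ℝ (u (sq j)) (X (sq j)) (wq j), wq j⟫ := by
    intro j
    have hs0 : 0 < -sq j := by linarith [hsq0 j]
    have hvpos : 0 < ‖vq j‖ := norm_pos_iff.2 (hvne j)
    have h1 := hvq j
    have e : ⟪fderiv ℝ (u (sq j)) (X (sq j)) (wq j), wq j⟫ =
        ‖vq j‖⁻¹ ^ 2 * ⟪fderiv ℝ (u (sq j)) (X (sq j)) (vq j), vq j⟫ := by
      simp only [hwq, map_smul, real_inner_smul_left, real_inner_smul_right]; ring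
    rw [e]
    have hsne : sq j ≠ 0 := (hsq0 j).ne
    have hvne' : ‖vq j‖ ≠ 0 := hvpos.ne'
    have h2 : κ' = (-sq j) * (‖vq j‖⁻¹ ^ 2 * (κ' / (-sq j) * ‖vq j‖ ^ 2)) := by
      field_simp
    rw [h2]
    exact mul_lt_mul_of_pos_left (mul_lt_mul_of_pos_left h1 (by positivity)) hs0
  choose mq tq htq hst using fun j => exists_fundamental_period_of_le hT1 (hsq1 j)
  have htq0 : ∀ j, tq j < 0 := fun j => by linarith [(htq j).2]
  have hneg_inv : ∀ s : ℝ, s < 0 → (-s) ^ (-n) = ((-s) ^ n)⁻¹ := fun s hs => Real.rpow_neg (by linarith) n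
  set yq : ℕ → EuclideanSpace ℝ (Fin 3) := fun j => ((-sq j) ^ (-n)) • X (sq j) with hyq
  -- the similarity positions at the bad times tend to the prescribed node
  have hy_lim : Tendsto yq atTop (𝓝 ys) := tendsto_simPos_of_tendsto_lattice hl hρ hX hrest hτ₀ hlat hsqτ hsq_bot
  have hXy : ∀ j, l ^ (mq j) • ((-tq j) ^ n • yq j) = X (sq j) := by
    intro j
    have hs0 : 0 < -sq j := by linarith [hsq0 j]
    have hp : 0 < (-sq j) ^ n := Real.rpow_pos_of_pos hs0 _
    simp only [hyq]
    rw [smul_smul, smul_smul, pow_mul_rpow_eq hl hρ (mq j) (htq0 j), ← hT, ← hst j, hneg_inv _ (hsq0 j),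
      mul_inv_cancel₀ hp.ne', one_smul]
  have hbad' : ∀ j, κ' < (-tq j) * ⟪fderiv ℝ (u (tq j)) ((-tq j) ^ n • yq j) (wq j), wq j⟫ := by
    intro j
    have h := stretching_transfer hl hρ hdss (mq j) (htq0 j) (yq j) (wq j)
    rw [hXy j, ← hT, ← hst j] at h
    rw [← h]
    exact hbad j
  set Kc : Set (ℝ × EuclideanSpace ℝ (Fin 3)) := Icc (-T) (-1) ×ˢ sphere 0 1 with hKc
  have hKcpt : IsCompact Kc := isCompact_Icc.prod (isCompact_sphere _ _)
  set z : ℕ → ℝ × EuclideanSpace ℝ (Fin 3) := fun j => (tq j, wq j) with hz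
  have hzK : ∀ j, z j ∈ Kc := fun j => ⟨htq j, mem_sphere_zero_iff_norm.2 (hwq1 j)⟩
  obtain ⟨zs, hzs, φ, hφ, hlim⟩ := hKcpt.tendsto_subseq hzK
  obtain ⟨ts, ws⟩ := zs
  obtain ⟨hts, hws⟩ := hzs
  rw [mem_sphere_zero_iff_norm] at hws
  have hts0 : ts < 0 := by linarith [hts.2]
  have ht_lim : Tendsto (fun j => tq (φ j)) atTop (𝓝 ts) := (continuous_fst.tendsto _).comp hlim
  have hw_lim : Tendsto (fun j => wq (φ j)) atTop (𝓝 ws) := (continuous_snd.tendsto _).comp hlim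
  have hyφ : Tendsto (fun j => yq (φ j)) atTop (𝓝 ys) := hy_lim.comp hφ.tendsto_atTop
  have hDcont : ContinuousOn (uncurry fun t x => fderiv ℝ (u t) x) (Iio (0:ℝ) ×ˢ univ) :=
    (hcl.smooth_velocity.fderiv_slice isOpen_Iio.uniqueDiffOn).continuousOn
  have hpt_lim : Tendsto (fun j => ((tq (φ j), (-tq (φ j)) ^ n • yq (φ j)) : ℝ × EuclideanSpace ℝ (Fin 3))) atTop
      (𝓝 (ts, (-ts) ^ n • ys)) := by
    refine ht_lim.prodMk_nhds ?_
    have hr : Tendsto (fun j => (-tq (φ j)) ^ n) atTop (𝓝 ((-ts) ^ n)) :=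
      (ht_lim.neg).rpow_const (Or.inl (by linarith))
    exact hr.smul hyφ
  have hA_lim : Tendsto (fun j => fderiv ℝ (u (tq (φ j))) ((-tq (φ j)) ^ n • yq (φ j))) atTop
      (𝓝 (fderiv ℝ (u ts) ((-ts) ^ n • ys))) := by
    have hmem : (ts, (-ts) ^ n • ys) ∈ Iio (0:ℝ) ×ˢ (univ : Set (EuclideanSpace ℝ (Fin 3))) := ⟨hts0, mem_univ _⟩
    exact (hDcont _ hmem).tendsto.comp (tendsto_nhdsWithin_iff.2 ⟨hpt_lim, Eventually.of_forall fun j =>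
      ⟨htq0 (φ j), mem_univ _⟩⟩)
  have hAw_lim : Tendsto (fun j => fderiv ℝ (u (tq (φ j))) ((-tq (φ j)) ^ n • yq (φ j)) (wq (φ j))) atTop
      (𝓝 (fderiv ℝ (u ts) ((-ts) ^ n • ys) ws)) :=
    (isBoundedBilinearMap_apply.continuous.tendsto _).comp (hA_lim.prodMk_nhds hw_lim)
  have hF_lim : Tendsto (fun j => (-tq (φ j)) * ⟪fderiv ℝ (u (tq (φ j))) ((-tq (φ j)) ^ n • yq (φ j)) (wq (φ j)), wq (φ j)⟫)
      atTop (𝓝 ((-ts) * ⟪fderiv ℝ (u ts) ((-ts) ^ n • ys) ws, ws⟫)) :=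
    ht_lim.neg.mul (hAw_lim.inner hw_lim)
  have hFge : κ' ≤ (-ts) * ⟪fderiv ℝ (u ts) ((-ts) ^ n • ys) ws, ws⟫ :=
    ge_of_tendsto hF_lim (Eventually.of_forall fun j => (hbad' (φ j)).le)
  have hle := hnode ts hts0 ws
  rw [hws, one_pow, mul_one] at hle
  linarith

/-! ### Non-vortical at one phase, non-vortical at every phase -/

/-- Along a permanent node the vorticity is either identically zero or never zero: `ω(τ₀, x*) = 0 ⇒ ω(t, (−t)ⁿy*) = 0` for all `t < 0`.
[cite: MajdaBertozziCUP2002, §1.6 Prop. 1.8 (1.51)] -/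
theorem curl_node_eq_zero_of_phase (hcl : IsClassicalEulerSolutionOn (Iio 0) 0 u p) (hL : ODE.IsUniformlyLipschitzOn u (Iio 0))
    {n : ℝ} {ys : EuclideanSpace ℝ (Fin 3)}
    (hnode : ∀ t : ℝ, t < 0 → u t ((-t) ^ n • ys) = (-(n * (-t) ^ (n - 1))) • ys)
    {τ₀ : ℝ} (hτ₀ : τ₀ < 0) (h0 : curl (u τ₀) ((-τ₀) ^ n • ys) = 0) {t : ℝ} (ht : t < 0) :
    curl (u t) ((-t) ^ n • ys) = 0 := by
  have h := curl_evolutionMap_any hcl hL hτ₀ ht ((-τ₀) ^ n • ys)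
  rw [evolutionMap_permanentNode hL hnode hτ₀ ht, h0, map_zero] at h
  exact h

/-! ### The trajectory-level dichotomy -/

/-- **DICHOTOMY FOR CONFINED BACKWARD TRAJECTORIES.**  Tame-clocked `l`-DSS member (global Type-I `K`, pressure clock `θ < 1`, pressure bounds on the moving
ball `R`), the permanent nodes of the ball `‖y‖ ≤ R` FINITE, the full stretching form `≤ κ < 1` at its NON-vortical permanent nodes.  Then a backward
trajectory confined to the moving ball either carries no vorticity at `τ₀`, or converges along the phase lattice to a VORTICAL permanent node of the ball.
[folklore] -/
theorem dss_curl_eq_zero_or_tendsto_vorticalNode (hcl : IsClassicalEulerSolutionOn (Iio 0) 0 u p) (hρ : 0 < ρ) (hl : 1 < l)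
    (hdss : ∀ τ : ℝ, τ < 0 → ∀ y, u τ y = (l ^ (1 + ρ)) • u ((l ^ (2 + ρ)) * τ) (l • y))
    {K : ℝ} (hK : ∀ s : ℝ, s < 0 → ∀ y : EuclideanSpace ℝ (Fin 3),
      (-s) * ‖fderiv ℝ (u s) y‖ ≤ K ∧ (-s) ^ (1 - (2 + ρ)⁻¹) * ‖u s y‖ ≤ K)
    (hθ : θ < 1)
    (hclock : ∀ s : ℝ, s < 0 → ∀ x : EuclideanSpace ℝ (Fin 3),
      (-s) * timeDerivWithin (Iio 0) p s x - (2 + ρ)⁻¹ * fderiv ℝ (p s) x x - 2 * (1 - (2 + ρ)⁻¹) * p s x ≤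
        θ * (1 - 2 * (2 + ρ)⁻¹) * ‖u s x + ((2 + ρ)⁻¹ / (-s)) • x‖ ^ 2)
    {R P₀ G κ : ℝ} (hκ : κ < 1)
    (hP₀ : ∀ s : ℝ, s < 0 → ∀ x : EuclideanSpace ℝ (Fin 3), ‖x‖ ≤ R * (-s) ^ (2 + ρ)⁻¹ →
      (-s) ^ (2 - 2 * (2 + ρ)⁻¹) * p s x ≤ P₀)
    (hG : ∀ s : ℝ, s < 0 → ∀ x : EuclideanSpace ℝ (Fin 3), ‖x‖ ≤ R * (-s) ^ (2 + ρ)⁻¹ →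
      (-s) ^ (2 - (2 + ρ)⁻¹) * ‖gradient (p s) x‖ ≤ G)
    (hfin : {y : EuclideanSpace ℝ (Fin 3) | ‖y‖ ≤ R ∧
      ∀ t : ℝ, t < 0 → u t ((-t) ^ (2 + ρ)⁻¹ • y) = (-((2 + ρ)⁻¹ * (-t) ^ ((2 + ρ)⁻¹ - 1))) • y}.Finite)
    (hnode0 : ∀ y : EuclideanSpace ℝ (Fin 3), ‖y‖ ≤ R →
      (∀ t : ℝ, t < 0 → u t ((-t) ^ (2 + ρ)⁻¹ • y) = (-((2 + ρ)⁻¹ * (-t) ^ ((2 + ρ)⁻¹ - 1))) • y) →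
      (∀ t : ℝ, t < 0 → curl (u t) ((-t) ^ (2 + ρ)⁻¹ • y) = 0) → ∀ t : ℝ, t < 0 → ∀ v : EuclideanSpace ℝ (Fin 3),
        (-t) * ⟪fderiv ℝ (u t) ((-t) ^ (2 + ρ)⁻¹ • y) v, v⟫ ≤ κ * ‖v‖ ^ 2)
    {τ₀ : ℝ} (hτ₀ : τ₀ < 0) {x₀ : EuclideanSpace ℝ (Fin 3)}
    (hconf : ∀ s : ℝ, s ≤ τ₀ → ‖ODE.evolutionMap u τ₀ s x₀‖ ≤ R * (-s) ^ (2 + ρ)⁻¹) :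
    curl (u τ₀) x₀ = 0 ∨ ∃ ys : EuclideanSpace ℝ (Fin 3), ‖ys‖ ≤ R ∧
      (∀ t : ℝ, t < 0 → u t ((-t) ^ (2 + ρ)⁻¹ • ys) = (-((2 + ρ)⁻¹ * (-t) ^ ((2 + ρ)⁻¹ - 1))) • ys) ∧
      curl (u τ₀) ((-τ₀) ^ (2 + ρ)⁻¹ • ys) ≠ 0 ∧
      Tendsto (fun j : ℕ => (l ^ j)⁻¹ • ODE.evolutionMap u τ₀ ((l ^ (2 + ρ)) ^ j * τ₀) x₀) atTop
        (𝓝 ((-τ₀) ^ (2 + ρ)⁻¹ • ys)) := by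
  have hρ2 : 0 < 2 + ρ := by linarith
  have hl0 : 0 < l := zero_lt_one.trans hl
  set n : ℝ := (2 + ρ)⁻¹ with hn
  have hn0 : 0 ≤ n := (inv_pos.2 hρ2).le
  have hn2 : n < 1 / 2 := by
    rw [hn, inv_lt_comm₀ hρ2 (by norm_num)]; norm_num; linarith
  have hΛc : ContinuousOn (fun s : ℝ => K / (-s)) (Iio 0) :=
    continuousOn_const.div continuousOn_neg fun s hs => by rw [mem_Iio] at hs; linarith
  have hΛ : ∀ s : ℝ, s < 0 → ∀ y, ‖fderiv ℝ (u s) y‖ ≤ K / (-s) := fun s hs y => by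
    rw [le_div_iff₀ (by linarith), mul_comm]; exact (hK s hs y).1
  have hlip : ODE.IsUniformlyLipschitzOn u (Iio 0) := isUniformlyLipschitzOn hcl hΛc hΛ
  set X : ℝ → EuclideanSpace ℝ (Fin 3) := fun s => ODE.evolutionMap u τ₀ s x₀ with hX
  have hXd : ∀ s : ℝ, s < 0 → HasDerivAt X (u s (X s)) s := fun s hs =>
    hlip.hasDerivAt_evolutionMap (convex_Iio 0) hτ₀ (Iio_mem_nhds hs) x₀
  have hconf' : ∀ s : ℝ, s ≤ τ₀ → ‖X s‖ ≤ R * (-s) ^ n := hconf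
  have hrest := tendsto_similaritySpeed_zero_of_clock hcl hn0 hn2 hθ hclock hτ₀ hXd hconf'
    (fun s hs => (hK s (by linarith) (X s)).2) (fun s hs => hP₀ s (by linarith) (X s) (hconf' s hs))
    (fun s hs => hG s (by linarith) (X s) (hconf' s hs))
  obtain ⟨ys, hysR, hysN, hlat⟩ := exists_tendsto_lattice_of_finite_nodes hcl hl hρ2 hdss hXd hrest hτ₀ hconf' hfin
  by_cases hv : curl (u τ₀) ((-τ₀) ^ n • ys) = 0
  · -- non-vortical node: subcritical at every phase, the trajectory is eventually subcritical, the vorticity dies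
    left
    have hall : ∀ t : ℝ, t < 0 → curl (u t) ((-t) ^ n • ys) = 0 := fun t ht =>
      curl_node_eq_zero_of_phase hcl hlip hysN hτ₀ hv ht
    have hκ' : κ < (1 + κ) / 2 := by linarith
    obtain ⟨σ₁, hσ₁τ, hsub⟩ := eventually_subcritical_of_tendsto_node hcl hl hρ2 hdss hκ' hτ₀ hXd hrest hlat
      (hnode0 ys hysR hysN hall)
    have hC : ∀ s : ℝ, s ≤ σ₁ → (-s) * ‖curl (u s) (ODE.evolutionMap u τ₀ s x₀)‖ ≤ 4 * K := by
      intro s hs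
      have hs0 : 0 < -s := by linarith [hs.trans hσ₁τ]
      have h1 := norm_curl_le_four_mul (u s) (X s)
      have h2 := (hK s (by linarith) (X s)).1
      calc (-s) * ‖curl (u s) (X s)‖ ≤ (-s) * (4 * ‖fderiv ℝ (u s) (X s)‖) := mul_le_mul_of_nonneg_left h1 hs0.le
        _ = 4 * ((-s) * ‖fderiv ℝ (u s) (X s)‖) := by ring
        _ ≤ 4 * K := by linarith
    exact curl_eq_zero_of_eventually_subcritical hcl hΛc hΛ hτ₀ hσ₁τ (by linarith : (1 + κ) / 2 < 1) hsub hC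
  · -- vortical node: the trajectory converges to it along the phase lattice
    right
    refine ⟨ys, hysR, hysN, hv, ?_⟩
    have hc := hlat.const_smul ((-τ₀) ^ n)
    refine hc.congr fun j => ?_
    simp only [hX]
    have hTj : (l ^ (2 + ρ)) ^ j * τ₀ < 0 := mul_neg_of_pos_of_neg (pow_pos (Real.rpow_pos_of_pos hl0 _) _) hτ₀
    have hp : 0 < (-((l ^ (2 + ρ)) ^ j * τ₀)) ^ n := Real.rpow_pos_of_pos (by linarith) _
    rw [smul_smul, Real.rpow_neg (by linarith) n, ← pow_mul_rpow_eq hl hρ2 j hτ₀, mul_inv,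
      show (-τ₀) ^ n * ((l ^ j)⁻¹ * ((-τ₀) ^ n)⁻¹) = (l ^ j)⁻¹ by
        field_simp [(Real.rpow_pos_of_pos (by linarith : (0:ℝ) < -τ₀) n).ne']]

/-! ### The member theorem -/

/-- **TAME DSS MEMBERS WITH A SUB-BERNOULLI PRESSURE CLOCK, FINITELY MANY PERMANENT NODES PER BALL AND SUBCRITICAL NON-VORTICAL NODES ARE TRIVIAL.**  Crux
hypotheses verbatim (every `ρ > 0`) + classical + `u(τ,y) = l^{1+ρ}u(l^{2+ρ}τ, ly)`, `p(τ,y) = l^{2+2ρ}p(l^{2+ρ}τ, ly)` (`l > 1`) + tame + pressure clock (`θ < 1`) + for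
every ball `‖y‖ ≤ R`: its permanent nodes are FINITELY MANY and a constant `κ < 1` bounds the full stretching form at the NON-VORTICAL ones (those whose self-similar
path carries no vorticity) ⇒ `u = 0` a.e.  Nothing is asked at VORTICAL permanent nodes: their backward basins are null (`volume_setOf_tendsto_vorticalNode_eq_zero`).
[folklore] -/
theorem ae_eq_zero_of_gauge_of_dss_of_clock_finiteNodes (hρ : 0 < ρ)
    {H : ℝ → EuclideanSpace ℝ (Fin 3) → EuclideanSpace ℝ (Fin 3) →L[ℝ] EuclideanSpace ℝ (Fin 3)} {c₀ : ℝ≥0}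
    (hsw : IsSuitableWeakSolutionOn (slab (EuclideanSpace ℝ (Fin 3)) (Iio 0) isOpen_Iio) 0 0 u p)
    (hH : HasWeakSpatialGradientOn (slab (EuclideanSpace ℝ (Fin 3)) (Iio 0) isOpen_Iio) u H)
    (hgauge : ∀ a : ℝ, 0 < a →
      ENNReal.ofReal (a ^ (2 * ρ)) * cknA a (0 : ℝ × EuclideanSpace ℝ (Fin 3)) u +
          ENNReal.ofReal (a ^ ρ) * cknE a (0 : ℝ × EuclideanSpace ℝ (Fin 3)) H +
        ENNReal.ofReal (a ^ (2 * ρ)) * cknD a (0 : ℝ × EuclideanSpace ℝ (Fin 3)) p ≤ (c₀ : ℝ≥0∞))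
    (hcl : IsClassicalEulerSolutionOn (Iio 0) 0 u p) (hl : 1 < l)
    (hdss : ∀ τ : ℝ, τ < 0 → ∀ y, u τ y = (l ^ (1 + ρ)) • u ((l ^ (2 + ρ)) * τ) (l • y))
    (hpdss : ∀ τ : ℝ, τ < 0 → ∀ y, p τ y = l ^ (2 + 2 * ρ) * p ((l ^ (2 + ρ)) * τ) (l • y))
    (htame : ∀ s t : ℝ, s < t → t < 0 → ∃ B : ℝ, ∀ τ ∈ Icc s t, ∀ y : EuclideanSpace ℝ (Fin 3),
      ‖u τ y‖ ≤ B ∧ ‖fderiv ℝ (u τ) y‖ ≤ B)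
    (hθ : θ < 1)
    (hclock : ∀ s : ℝ, s < 0 → ∀ x : EuclideanSpace ℝ (Fin 3),
      (-s) * timeDerivWithin (Iio 0) p s x - (2 + ρ)⁻¹ * fderiv ℝ (p s) x x - 2 * (1 - (2 + ρ)⁻¹) * p s x ≤
        θ * (1 - 2 * (2 + ρ)⁻¹) * ‖u s x + ((2 + ρ)⁻¹ / (-s)) • x‖ ^ 2)
    (hfin : ∀ R : ℝ, {y : EuclideanSpace ℝ (Fin 3) | ‖y‖ ≤ R ∧
      ∀ t : ℝ, t < 0 → u t ((-t) ^ (2 + ρ)⁻¹ • y) = (-((2 + ρ)⁻¹ * (-t) ^ ((2 + ρ)⁻¹ - 1))) • y}.Finite)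
    (hnodes : ∀ R : ℝ, 0 < R → ∃ κ : ℝ, κ < 1 ∧
      ∀ y : EuclideanSpace ℝ (Fin 3), ‖y‖ ≤ R →
        (∀ t : ℝ, t < 0 → u t ((-t) ^ (2 + ρ)⁻¹ • y) = (-((2 + ρ)⁻¹ * (-t) ^ ((2 + ρ)⁻¹ - 1))) • y) →
        (∀ t : ℝ, t < 0 → curl (u t) ((-t) ^ (2 + ρ)⁻¹ • y) = 0) → ∀ t : ℝ, t < 0 → ∀ v : EuclideanSpace ℝ (Fin 3),
          (-t) * ⟪fderiv ℝ (u t) ((-t) ^ (2 + ρ)⁻¹ • y) v, v⟫ ≤ κ * ‖v‖ ^ 2) :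
    uncurry u =ᵐ[volume.restrict (Iio (0 : ℝ) ×ˢ (univ : Set (EuclideanSpace ℝ (Fin 3))))] 0 := by
  -- adapted from `SimilarityBernoulli.ae_eq_zero_of_gauge_of_dss_of_clock_depletion`: the confined vortical set is NULL instead of empty
  have hρ2 : 0 < 2 + ρ := by linarith
  have hl0 : 0 < l := zero_lt_one.trans hl
  have hn0 : 0 < (2 + ρ)⁻¹ := inv_pos.2 hρ2
  obtain ⟨B, hB⟩ := htame (-(l ^ (2 + ρ))) (-1) (by linarith [Real.one_lt_rpow hl hρ2]) (by norm_num)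
  have hK := exists_typeI_of_dss_tame hl hρ2 (by linarith) hdss hB
  set K : ℝ := l ^ (2 + ρ) * B with hKdef
  have hΛc : ContinuousOn (fun s : ℝ => K / (-s)) (Iio 0) :=
    continuousOn_const.div continuousOn_neg fun s hs => by rw [mem_Iio] at hs; linarith
  have hΛ : ∀ s : ℝ, s < 0 → ∀ y, ‖fderiv ℝ (u s) y‖ ≤ K / (-s) := fun s hs y => by
    rw [le_div_iff₀ (by linarith), mul_comm]; exact (hK s hs y).1
  have hlip : ODE.IsUniformlyLipschitzOn u (Iio 0) := isUniformlyLipschitzOn hcl hΛc hΛ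
  refine ae_eq_zero_of_gauge_of_piercing_of_confinedNull_allRho (n := (2 + ρ)⁻¹) hρ hsw hH hgauge hcl hΛc hΛ
    (fun R₀ => ?_) (fun τ₀ hτ₀ R hR => ?_)
  · set R : ℝ := max R₀ (K / (2 + ρ)⁻¹ + 1) with hRdef
    have hbR : K < (2 + ρ)⁻¹ * R := by
      have h1 : K / (2 + ρ)⁻¹ + 1 ≤ R := le_max_right _ _
      have h2 : K / (2 + ρ)⁻¹ < R := by linarith
      rwa [div_lt_iff₀ hn0, mul_comm] at h2
    exact ⟨R, le_max_left _ _, fun σ hσ x hx hfast =>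
      absurd hfast (not_le.2 (noFastInflow_of_boundedSpeed hσ hbR (fun y _ => (hK σ hσ y).2) hx))⟩
  · obtain ⟨P₀, G, hPG⟩ := exists_pressure_core_bounds_of_dss hcl.smooth_pressure hl hρ2 hpdss R
    obtain ⟨κ, hκ, hnode0⟩ := hnodes R hR
    -- the confined vortical set lies in the union of the null basins of the vortical permanent nodes of the ball
    set N : Set (EuclideanSpace ℝ (Fin 3)) := {y | ‖y‖ ≤ R ∧
      ∀ t : ℝ, t < 0 → u t ((-t) ^ (2 + ρ)⁻¹ • y) = (-((2 + ρ)⁻¹ * (-t) ^ ((2 + ρ)⁻¹ - 1))) • y} with hNdef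
    have hsub : {x : EuclideanSpace ℝ (Fin 3) | curl (u τ₀) x ≠ 0 ∧
        ∀ σ : ℝ, σ ≤ τ₀ → ‖ODE.evolutionMap u τ₀ σ x‖ < R * (-σ) ^ (2 + ρ)⁻¹} ⊆
        ⋃ ys ∈ N, {x : EuclideanSpace ℝ (Fin 3) | curl (u τ₀) ((-τ₀) ^ (2 + ρ)⁻¹ • ys) ≠ 0 ∧
          Tendsto (fun j : ℕ => (l ^ j)⁻¹ • ODE.evolutionMap u τ₀ ((l ^ (2 + ρ)) ^ j * τ₀) x) atTop
            (𝓝 ((-τ₀) ^ (2 + ρ)⁻¹ • ys))} := by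
      intro x hx
      rcases dss_curl_eq_zero_or_tendsto_vorticalNode hcl hρ hl hdss hK hθ hclock hκ (fun s hs y hy => (hPG s hs y hy).1)
          (fun s hs y hy => (hPG s hs y hy).2) (hfin R) hnode0 hτ₀ (fun s hs => (hx.2 s hs).le) with h0 | ⟨ys, hysR, hysN, hv, ht⟩
      · exact absurd h0 hx.1
      · exact mem_biUnion (show ys ∈ N from ⟨hysR, hysN⟩) ⟨hv, ht⟩
    refine measure_mono_null hsub ((measure_biUnion_null_iff (hfin R).countable).2 fun ys hys => ?_)
    by_cases hv : curl (u τ₀) ((-τ₀) ^ (2 + ρ)⁻¹ • ys) = 0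
    · have : {x : EuclideanSpace ℝ (Fin 3) | curl (u τ₀) ((-τ₀) ^ (2 + ρ)⁻¹ • ys) ≠ 0 ∧
          Tendsto (fun j : ℕ => (l ^ j)⁻¹ • ODE.evolutionMap u τ₀ ((l ^ (2 + ρ)) ^ j * τ₀) x) atTop
            (𝓝 ((-τ₀) ^ (2 + ρ)⁻¹ • ys))} = ∅ :=
        eq_empty_iff_forall_notMem.2 fun x hx => hx.1 hv
      rw [this, measure_empty]
    · refine measure_mono_null (fun x hx => hx.2) ?_
      exact volume_setOf_tendsto_vorticalNode_eq_zero hcl hlip hl hρ hdss hys.2 hτ₀ hv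

end Summit.NavierStokesRegularity.NavierStokesRegularity.Theorems.PowerGaugeEulerLiouville.DSSNodes

end
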